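import Summits.Ventures.PercRepro.RankLevelSetRuleQTwelveCertDefsHi1

/-!
# PercRepro — THE PARTIAL PRODUCTS OF THE UPPER CERTIFICATE OF THE FAMILY `k = 12` (p4, gen 25; C-044; paper §13.7): the two identities
`N^h·na + D^h·nb = P^h` (`h = A, B`; the upper convergent, eighths of the short factor), each one `ring` with the short half-factor on the left.
No `sorry`; axioms standard.
-/

namespace PercRepro

set_option maxHeartbeats 6400000 in
set_option maxRecDepth 16384 in
/-- The partial product identity A of the upper certificate: `N_21^A·na + D_21^A·nb` in `(q, m)` — the short part
(23 + 24 monomials) on the left of each product. -/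
lemma twelve_upper_prodA (q m : ℚ) :
    cfTwentyOneN8A q m * naTwelve q m + cfTwentyOneD8A q m * nbTwelve q m = pUpperTwelveA q m := by
  unfold cfTwentyOneN8A cfTwentyOneD8A naTwelve nbTwelve pUpperTwelveA; ring

set_option maxHeartbeats 6400000 in
set_option maxRecDepth 16384 in
/-- The partial product identity B of the upper certificate: `N_21^B·na + D_21^B·nb` in `(q, m)` — the short part
(23 + 25 monomials) on the left of each product. -/
lemma twelve_upper_prodB (q m : ℚ) :
    cfTwentyOneN8B q m * naTwelve q m + cfTwentyOneD8B q m * nbTwelve q m = pUpperTwelveB q m := by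
  unfold cfTwentyOneN8B cfTwentyOneD8B naTwelve nbTwelve pUpperTwelveB; ring

end PercRepro
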